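import Literature.NumberTheory.EllipticCurves.Tian2014.CMPointSystemFourTorsion
import Literature.NumberTheory.EllipticCurves.Tian2014.CMPointSystemDescentPrimeBase
import Literature.NumberTheory.EllipticCurves.Tian2014.CMPointSystemSpecialTransversal
import HarnessLib

/-!
# Tian 2014 Prop. 4.6 (= Monsky 1990 Thm. 4.5, the `2p₇` case) transplanted onto the CM-point system:
# for `n = p ≡ 7 (mod 8)` prime, `2y_{2p} ∈ E(ℚ(√−2p))⁻ ∖ (2E(ℚ(√−2p))⁻ + E[2])` — the EVEN twist of the
# `p₀ ≡ 7 (mod 8)` case, from the printed system plus two printed sentences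

Cell `bsd-monsky` (prover-A seat, g13; `run/shared/lean/pub/bsd-monsky/`). HONEST FRAMING (README §1): nothing is
asserted about BSD, nothing booked, no `_holds`; theorems on the data `D : CMPointData n` of `CMPointSystemDisplays.lean`
with Tian's printed properties as hypotheses, plus pure algebra on `E : y² = x³ − x`. NOTHING NEW ON PAPER: Tian
proves Prop. 4.6 in print (Monsky [19] Thm. 4.5); this is the `k = 0` base case of the induction whose `k = 1` step is the
cell's enclosure, here for `m = 2p₀`, `p₀ ≡ 7 (mod 8)` (the sibling `CMPointSystemDescentPrimeBase.lean` did `p₀ ≡ 3 (8)`).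

## Source (verbatim, arXiv:1210.8231, Prop. 4.6 proof, the `p₀ ≡ 7 mod 8` case, p0024 L6–L30)

"Assume now that `p₀ ≡ 7 mod 8`. Then `m = p₀` or `2p₀` corresponding `χ` non-trivial or trivial. We need to show that
`2y_m ∉ 2E(ℚ(√−m))⁻ + E[2]`. Suppose this is not the case, i.e. `2y_m = 2y mod E[2]` for some `y ∈ E(ℚ(√−m))⁻`. Since
`φ` has even cardinality, `y_m` is rational over `H`. Then `P := y_m − y ∈ E[4] ∩ E(H) = E[4] ∩ E(ℚ(√2))` and
therefore `P = 0` or `(1 + √2, 2 + √2)` modulo `E[2]`. Note that `𝒜[2^∞]` is cyclic by Gauss' genus theory. Take an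
element `[t] ∈ 𝒜 − 2𝒜` … take `φ = ⋃_{i=0}^{m−1} [t]^i φ₀` if the order of `[t]` is `2m` (thus `[t]^m = [ϖ′]`). Use this
`φ` to define `y_m`. Now we have `y^{σ_t}_{m,φ} = … = χ(t) y_{m,φ} + (1, 0)`. Note that `σ_t` fixes `√−2p₀` but moves
`√2` and `√−p₀`. Thus `σ_t y = χ(t) y` and then `P^{σ_t} − χ(t)P = y^{σ_t}_m − χ(t) y_m = (1, 0)`. But we have shown
that `P = 0` or `(1 + √2, 2 + √2)` modulo `E[2]`. If follows that `P^{σ_t} − χ(t)P = 0` if `P = 0 mod E[2]` and that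
`P^{σ_t} − χ(t)P = (−1, 0)` or `(0, 0)` if `P = (1 + √2, 2 + √2) mod E[2]` according to `χ(t) = 1` or `−1`. It is a
contradiction."

## What is proved here (kernel), and from what

* §1 on `E[4]`: a `4`-torsion point FIXED by an automorphism moving `i` and fixing `√2` has `2P ∈ {O, (1,0)}`
  (`two_nsmul_eq_zero_or_ptOne_of_map_eq_self`); a point with `2P = (1,0)` is moved by an automorphism negating `√2`
  and `σ(P) − P ∉ {O, (1,0)}` (`map_sub_ne_zero_and_ne_ptOne_of_two_nsmul_eq_ptOne`) — Tian's "`P^{σ_t} − P = (−1,0)` or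
  `(0,0)`" for the trivial character, read as "`≠ (1,0)`".
* §2 on the data (`χ = χ_{2n}` trivial, `m = 2n`): `σ_t(y_{2n,φ}) = y_{2n,φ} + (1,0)` for Tian's transversal
  (`act_art_yPoint_eq_add_ptOne`; Thm. 2.8 (3) with `n ≡ 7 (8)`, `#φ₀` odd), and the descent
  `CMPointData.exists_transfer_eq_two_nsmul_yPoint_not_two_smul_add_torsion_seven`: for `n ≡ 7 (8)` with
  `𝒜[2] = {1, [ϖ′]}` and EVERY transversal `φ`, the rational `y″` with `transfer y″ = 2y_{2n,φ}` lies outside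
  `2E_{2n}(ℚ) + tor` (both parities of `#φ` are handled: odd by `CMPointSystemFourTorsion`, even by §1).
* §3 `n = p ≡ 7 (8)` prime: `𝒜[2] = {1, [ϖ′]}` from Gauss's count `#Cl_K[2] = 2` (a tree theorem), hence
  `…_prime_seven_mod_eight` — Monsky Thm. 4.5 / Cor. 5.15 (1) «`2p₇`» for Tian's point.
* INPUTS beyond `D.Printed`, as BINDERS (no new named fact): `hτ2 : ∀ s, s² = 2 → σ_{1+ϖ}(s) = s` («`σ_{1+ϖ}` moves `i`
  but fixes `√2`», p0024 L1) and `hgen : ∀ t, [t] ∉ 2𝒜 → ∀ s, s² = 2 → σ_t(s) = −s` («`σ_t` … moves `√2`» for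
  `[t] ∈ 𝒜 − 2𝒜`, p0024 L26 — Tian's Notations (ii) «`2𝒜 ≃ Gal(H/H₀)`» with `√2 ∈ H₀ = K(√−p₀)`, p0022 L52–L56).
* NOT here: the ODD twist `m = p₀` (`χ = χ_{p₀}` non-trivial): it needs the second-twist rationality of `2y_{p₀}` over
  `ℚ(√−p₀)` (`√−p₀ ∈ H` with its Galois actions) — left as printed.

[cite: Tian2014, Prop. 4.6 and its proof (arXiv:1210.8231 p0023 L15–L22, p0024 L6–L30), §4.2 (p0022 L47–L70)]
[cite: Monsky1990MockHeegner, Thm. 4.5 (p. 57), Cor. 5.15 (1) (p. 66)] [cite: Cox2013, Prop. 3.11] [cite: LiMa2008, Thm. 0.4]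
-/

noncomputable section

open scoped Classical

open WeierstrassCurve WeierstrassCurve.Affine NumberField Literature.NumberTheory.EllipticCurves
  Literature.NumberTheory.EllipticCurves.TianYuanZhang2017 Literature.NumberTheory.QuadraticFields.RedeiReichardt
open Literature.NumberTheory.EllipticCurves.Monsky1990 (baseChange_coeffs negY_eq sq_eq_of_nonsingular exists_two_nsmul_some_eq eq_of_two_nsmul_eq_zero map_sub_self_eq_zero_of_two_nsmul_eq_zero rho)

set_option autoImplicit false

namespace Literature.NumberTheory.EllipticCurves.Tian2014

/-! ## §1 Two more facts on `E[4]` (Tian p0024 L11–L14, L26–L30) -/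

section FourTorsionSeven

variable {H : Type} [Field H] [CharZero H]

/-- **A `4`-torsion point FIXED by an automorphism moving `i` and fixing `√2` has `2P ∈ {O, (1,0)}`** ("`P ∈ E[4] ∩
E(H) = E[4] ∩ E(ℚ(√2))` and therefore `P = 0` or `(1 + √2, 2 + √2)` modulo `E[2]`"): `2P = (0,0)` would force
`σ(x) = −x ≠ x`, `2P = (−1,0)` would force `σ(y) = −y ≠ y`. [cite: Tian2014, Prop. 4.6 proof (p0024 L11–L14)] -/
theorem two_nsmul_eq_zero_or_ptOne_of_map_eq_self (σ : H ≃ₐ[ℚ] H) (im : H) (him : im ^ 2 = -1)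
    (hσi : σ im = -im) (hσ2 : ∀ s : H, s ^ 2 = 2 → σ s = s) (P : EPoint H)
    (hP : (2 : ℕ) • ((2 : ℕ) • P) = 0)
    (hfix : Point.map (W' := congruentNumberCurve 1) σ.toAlgHom P = P) :
    (2 : ℕ) • P = 0 ∨ (2 : ℕ) • P = ptOne := by
  rcases eq_of_two_nsmul_eq_zero _ hP with h2P | h2P | h2P | h2P
  · exact Or.inl h2P
  all_goals
    rcases P with _ | ⟨x, y, h⟩
    · rw [← Point.zero_def, smul_zero] at h2P; exact absurd h2P.symm (Point.some_ne_zero _)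
    have heq : y ^ 2 = x ^ 3 - x := sq_eq_of_nonsingular h
    have hy : y ≠ 0 := by
      intro hy0
      rw [two_nsmul, Point.add_self_of_Y_eq (by rw [negY_eq, hy0, neg_zero])] at h2P
      exact Point.some_ne_zero _ h2P.symm
    obtain ⟨y₂, h₂, h2eq⟩ := exists_two_nsmul_some_eq h hy
    have hrho : rho 0 x y * (2 * y) = x ^ 2 + 1 := by
      unfold rho
      rw [div_mul_cancel₀ _ (mul_ne_zero two_ne_zero hy)]
      ring
    have hx₂ : rho 0 x y ^ 2 * (4 * y ^ 2) = (x ^ 2 + 1) ^ 2 := by rw [← hrho]; ring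
    rw [h2eq] at h2P
    have hX := (Point.some.inj h2P).1
    rw [Point.map_some] at hfix
    have hfix' := Point.some.inj hfix
    simp only [AlgEquiv.coe_toAlgHom] at hfix'
    obtain ⟨hσx, hσy⟩ := hfix'
  · -- `2P = (0,0)`: `x² = −1`, `σ(x) = −x`, contradiction with `σ(x) = x`
    exfalso
    have hx2 : x ^ 2 = -1 := by
      rw [hX, zero_mul] at hx₂
      have h0 : (x ^ 2 + 1) ^ 2 = 0 := hx₂.symm
      have := pow_eq_zero_iff (n := 2) (by norm_num) |>.mp h0
      linear_combination this
    have hσx' : σ x = -x := by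
      have hfac : (x - im) * (x + im) = 0 := by linear_combination hx2 - him
      rcases mul_eq_zero.mp hfac with e | e
      · have : x = im := by linear_combination e
        rw [this, hσi]
      · have : x = -im := by linear_combination e
        rw [this, map_neg, hσi, neg_neg]
    have hx0 : x ≠ 0 := by intro e; rw [e] at hx2; norm_num at hx2
    apply hx0
    rw [hσx'] at hσx
    linear_combination -hσx / 2
  · exact Or.inr (h2eq.trans h2P)
  · -- `2P = (−1,0)`: `(x + 1)² = 2`, `σ(y) = −y`, contradiction with `σ(y) = y` (`y ≠ 0`)
    exfalso
    have hs : (x + 1) ^ 2 = 2 := by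
      rw [hX, neg_one_mul] at hx₂
      have key : (x ^ 2 + 2 * x - 1) ^ 2 = 0 := by linear_combination -hx₂ - 4 * heq
      have := pow_eq_zero_iff (n := 2) (by norm_num) |>.mp key
      linear_combination this
    have hσs : σ (x + 1) = x + 1 := hσ2 _ hs
    have hσx' : σ x = x := by
      have := hσs; rw [map_add, map_one] at this; linear_combination this
    have hy' : y = im * ((x + 1) * x) ∨ y = -(im * ((x + 1) * x)) := by
      have hfac : (y - im * ((x + 1) * x)) * (y + im * ((x + 1) * x)) = 0 := by
        linear_combination heq + (x ^ 2 + x) * hs - (x + 1) ^ 2 * x ^ 2 * him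
      rcases mul_eq_zero.mp hfac with e | e
      · left; linear_combination e
      · right; linear_combination e
    have hσy' : σ y = -y := by
      rcases hy' with rfl | rfl
      · rw [map_mul, map_mul, hσs, hσx', hσi]; ring
      · rw [map_neg, map_mul, map_mul, hσs, hσx', hσi]; ring
    apply hy
    rw [hσy'] at hσy
    linear_combination -hσy / 2

/-- **A point with `2P = (1,0)` is moved by an automorphism negating `√2`, and not to `−P`**: `(x − 1)² = 2` and
`σ(x − 1) = −(x − 1)`, so `σ(x) = 2 − x ≠ x`; hence `σ(P) − P ∉ {O, (1,0)}` (`σ(P) = P + (1,0) = −P` would give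
`σ(x) = x`). Tian: "`P^{σ_t} − χ(t)P = (−1,0)` or `(0,0)` if `P = (1 + √2, 2 + √2) mod E[2]`" — the two excluded
values are exactly `O` and `(1,0)`. [cite: Tian2014, Prop. 4.6 proof (p0024 L26–L30)] -/
theorem map_sub_ne_zero_and_ne_ptOne_of_two_nsmul_eq_ptOne (σ : H ≃ₐ[ℚ] H)
    (hσ2 : ∀ s : H, s ^ 2 = 2 → σ s = -s) (P : EPoint H) (hP : (2 : ℕ) • P = ptOne) :
    Point.map (W' := congruentNumberCurve 1) σ.toAlgHom P - P ≠ 0 ∧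
    Point.map (W' := congruentNumberCurve 1) σ.toAlgHom P - P ≠ ptOne := by
  rcases P with _ | ⟨x, y, h⟩
  · rw [← Point.zero_def, smul_zero] at hP; exact absurd hP.symm (Point.some_ne_zero _)
  have heq : y ^ 2 = x ^ 3 - x := sq_eq_of_nonsingular h
  have hy : y ≠ 0 := by
    intro hy0
    rw [two_nsmul, Point.add_self_of_Y_eq (by rw [negY_eq, hy0, neg_zero])] at hP
    exact Point.some_ne_zero _ hP.symm
  obtain ⟨y₂, h₂, h2eq⟩ := exists_two_nsmul_some_eq h hy
  have hrho : rho 0 x y * (2 * y) = x ^ 2 + 1 := by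
    unfold rho
    rw [div_mul_cancel₀ _ (mul_ne_zero two_ne_zero hy)]
    ring
  have hx₂ : rho 0 x y ^ 2 * (4 * y ^ 2) = (x ^ 2 + 1) ^ 2 := by rw [← hrho]; ring
  have hP' := hP
  rw [h2eq] at hP'
  have hX := (Point.some.inj hP').1
  have hs : (x - 1) ^ 2 = 2 := by
    rw [hX, one_mul] at hx₂
    have key : (x ^ 2 - 2 * x - 1) ^ 2 = 0 := by linear_combination -hx₂ + 4 * heq
    have := pow_eq_zero_iff (n := 2) (by norm_num) |>.mp key
    linear_combination this
  have hσs : σ (x - 1) = -(x - 1) := hσ2 _ hs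
  have hs0 : x - 1 ≠ 0 := by intro e; rw [e] at hs; norm_num at hs
  have hσx : σ x ≠ x := by
    intro e
    apply hs0
    rw [map_sub, map_one, e] at hσs
    linear_combination hσs / 2
  -- `σ(P) ≠ P` and `σ(P) ≠ −P`: both would force `σ(x) = x`
  have hne1 : Point.map (W' := congruentNumberCurve 1) σ.toAlgHom (Point.some x y h) ≠ Point.some x y h := by
    intro e
    rw [Point.map_some] at e
    have := (Point.some.inj e).1
    simp only [AlgEquiv.coe_toAlgHom] at this
    exact hσx this
  have hne2 : Point.map (W' := congruentNumberCurve 1) σ.toAlgHom (Point.some x y h) ≠ -Point.some x y h := by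
    intro e
    rw [Point.map_some, Point.neg_some] at e
    have := (Point.some.inj e).1
    simp only [AlgEquiv.coe_toAlgHom] at this
    exact hσx this
  refine ⟨fun e => hne1 (sub_eq_zero.mp e), fun e => hne2 ?_⟩
  -- `σ(P) = P + (1,0) = P + 2P = 3P = −P` since `4P = 0`
  rw [sub_eq_iff_eq_add] at e
  have h4 : (2 : ℕ) • ((2 : ℕ) • (Point.some x y h : EPoint H)) = 0 := by rw [hP, two_nsmul_ptOne]
  rw [e, ← hP, eq_neg_iff_add_eq_zero, add_assoc, ← two_nsmul, ← two_nsmul]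
  exact h4

end FourTorsionSeven

/-! ## §2 The descent for `n ≡ 7 (mod 8)` with `𝒜[2] = {1, [ϖ′]}` (Tian Prop. 4.6, the `p₀ ≡ 7 (mod 8)` even twist) -/

namespace CMPointData

variable {n : ℕ}

/-- **`σ_t(y_{2n,φ}) = y_{2n,φ} + (1,0)` for Tian's transversal** (`n ≡ 7 (8)`, `t` a non-square of order `2m`,
`φ = ⋃_{i<m} t^i φ₀`): `Σ_φ z_{ta} = Σ_{i<m} Σ_{φ₀} z_{t^{i+1}u} = y_φ + Σ_{φ₀}(z_{[ϖ′]u} − z_u) = y_φ + #φ₀·(1,0)`,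
`#φ₀` odd. [cite: Tian2014, Prop. 4.6 proof (p0024 L20–L25)] -/
theorem act_art_yPoint_eq_add_ptOne (D : CMPointData n) (hn8 : n % 8 = 7) (h3 : D.thm28_3) (h48 : D.eq48)
    (t : ClassGroup (𝓞 (GenusField (2 * n)))) {φ φ₀ : Finset (ClassGroup (𝓞 (GenusField (2 * n))))} {m : ℕ}
    (htm : t ^ m = D.piPrime) (hodd : Odd φ₀.card)
    (hsum : ∀ {M : Type} [AddCommGroup M] (f : ClassGroup (𝓞 (GenusField (2 * n))) → M),
      ∑ a ∈ φ, f a = ∑ i ∈ Finset.range m, ∑ u ∈ φ₀, f (t ^ i * u)) :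
    D.act (D.art t) (D.yPoint φ) = D.yPoint φ + ptOne := by
  classical
  set g : ℕ → EPoint D.H := fun i => ∑ u ∈ φ₀, D.z (t ^ i * u) with hg
  have hL : D.act (D.art t) (D.yPoint φ) = ∑ i ∈ Finset.range m, g (i + 1) := by
    rw [yPoint, map_sum, Finset.sum_congr rfl (fun a _ => h48 t a), hsum (fun a => D.z (t * a))]
    exact Finset.sum_congr rfl (fun i _ => Finset.sum_congr rfl (fun u _ => by rw [pow_succ', mul_assoc]))
  have hR : D.yPoint φ = ∑ i ∈ Finset.range m, g i := by rw [yPoint, hsum D.z]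
  have htele : ∑ i ∈ Finset.range m, g (i + 1) = ∑ i ∈ Finset.range m, g i + (g m - g 0) := by
    have e1 := Finset.sum_range_succ g m
    have e2 := Finset.sum_range_succ' g m
    rw [e2] at e1
    rw [eq_sub_iff_add_eq.mpr e1.symm]
    abel
  have hdiff : g m - g 0 = ptOne := by
    rw [hg]
    simp only [pow_zero, one_mul, htm]
    rw [← Finset.sum_sub_distrib, Finset.sum_congr rfl (fun u _ => h3 u), Finset.sum_const, if_pos hn8,
      odd_nsmul_of_two_nsmul_eq_zero two_nsmul_ptOne hodd]
  rw [hL, htele, hdiff, ← hR]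

/-- **Tian Prop. 4.6, the `p₀ ≡ 7 (mod 8)` EVEN twist, on the data**: for a system `D` with the printed properties,
`n ≡ 7 (8)`, `𝒜[2] = {1, [ϖ′]}`, `σ_{1+ϖ}` fixing the square roots of `2` (p0024 L1) and `σ_t` NEGATING them for
every non-square `t` (Tian's Notations (ii) "`2𝒜 ≃ Gal(H/H₀)`" with `√2 ∈ H₀`: "`σ_t` fixes `√−2p₀` but moves `√2`",
p0024 L26), and EVERY transversal `φ` of `𝒜/[ϖ′]`: the rational point `y″` with `transfer y″ = 2y_{2n,φ}` is NOT of
the form `2z + t` with `t` torsion. Proof (Tian p0024 L6–L30, on Tian's transversal `ψ`, with `2y_φ = 2y_ψ`): if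
`2y_ψ = 2S + T` put `P := y_ψ − S`, `4P = 0`; if `#ψ` is odd, `σ_{1+ϖ}(P) − P = (0,0)` — impossible
(`CMPointSystemFourTorsion`); if `#ψ` is even, `σ_{1+ϖ}` fixes `P`, so `2P ∈ {O, (1,0)}`, while `σ_t(P) − P =
σ_t(y_ψ) − y_ψ = (1,0)` — impossible in both cases (`P ∈ E[2]` is fixed by `σ_t`; a point with `2P = (1,0)` is
moved by `σ_t` off `{P, −P}`). [cite: Tian2014, Prop. 4.6 (p0023 L15–L22) and its proof (p0024 L6–L30), §4.2 (p0022 L52–L56)] -/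
theorem exists_transfer_eq_two_nsmul_yPoint_not_two_smul_add_torsion_seven (D : CMPointData n) (hn : n ≠ 0)
    (hn8 : n % 8 = 7) (hsq2n : Squarefree (2 * n)) (hP : D.Printed)
    (hτ2 : ∀ s : D.H, s ^ 2 = 2 → D.tau s = s)
    (hgen : ∀ t : ClassGroup (𝓞 (GenusField (2 * n))), ¬ IsSquare t → ∀ s : D.H, s ^ 2 = 2 → D.art t s = -s)
    (h2 : ∀ u : ClassGroup (𝓞 (GenusField (2 * n))), u * u = 1 → u = 1 ∨ u = D.piPrime)
    {φ : Finset (ClassGroup (𝓞 (GenusField (2 * n))))} (hφ : D.IsRepsModPiPrime φ) :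
    ∃ y' : (congruentNumberCurve (2 * n)).toAffine.Point, D.transfer hn y' = (2 : ℕ) • D.yPoint φ ∧
      ∀ z t : (congruentNumberCurve (2 * n)).toAffine.Point, IsOfFinAddOrder t → y' ≠ (2 : ℤ) • z + t := by
  classical
  have hP' := hP
  obtain ⟨h1, -, h3, h48, hart, ⟨htaui, htauθ, -⟩, -, -, -, hπ, hπ1⟩ := hP'
  -- a non-square `t` and Tian's transversal `ψ`
  obtain ⟨t, ht⟩ := exists_not_isSquare_of_mul_self_eq_one D.piPrime hπ hπ1
  obtain ⟨ψ, ψ₀, m, -, htm, hodd₀, hψ, hsum⟩ := exists_special_transversal D.piPrime h2 t ht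
  have h2y : (2 : ℕ) • D.yPoint φ = (2 : ℕ) • D.yPoint ψ := D.two_nsmul_yPoint_eq_of_isReps h3 hπ hψ hφ
  obtain ⟨y', hy'⟩ := D.exists_transfer_eq_two_nsmul_yPoint hn hP hψ
  refine ⟨y', by rw [hy', h2y], ?_⟩
  intro z t₀ ht₀ heq
  have ht2 : (2 : ℕ) • t₀ = 0 := two_nsmul_eq_zero_of_isOfFinAddOrder_congruentNumberCurve hsq2n ht₀
  set S : EPoint D.H := D.transfer hn z with hS
  set T : EPoint D.H := D.transfer hn t₀ with hT
  have hyST : (2 : ℕ) • D.yPoint ψ = (2 : ℕ) • S + T := by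
    rw [← hy', heq, map_add, map_zsmul, two_zsmul, two_nsmul]
  have hT2 : (2 : ℕ) • T = 0 := by rw [hT, ← map_nsmul, ht2, map_zero]
  set P : EPoint D.H := D.yPoint ψ - S with hPdef
  have h2P : (2 : ℕ) • P = T := by rw [hPdef, smul_sub, hyST]; abel
  have h4P : (2 : ℕ) • ((2 : ℕ) • P) = 0 := by rw [h2P, hT2]
  have hSτ : D.act D.tau S = S := by
    rw [hS]; exact act_transferE_of_fix (2 * n) _ _ _ _ htauθ z
  have hSσ : D.act (D.art t) S = S := by
    rw [hS]; exact act_transferE_of_fix (2 * n) _ _ _ _ (hart t).2 z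
  -- `σ_t(P) − P = (1,0)`
  have hσP : D.act (D.art t) P - P = ptOne := by
    rw [hPdef, map_sub, hSσ, D.act_art_yPoint_eq_add_ptOne hn8 h3 h48 t htm hodd₀ hsum]; abel
  rcases Nat.even_or_odd ψ.card with ⟨k, hk⟩ | hodd
  · -- `#ψ` even: `σ_{1+ϖ}` fixes `P`, so `2P ∈ {O, (1,0)}`
    have hz : (k + k) • (ptZero : EPoint D.H) = 0 := by
      rw [add_nsmul, ← smul_add, ← two_nsmul, two_nsmul_ptZero, smul_zero]
    have hyτ : D.act D.tau (D.yPoint ψ) = D.yPoint ψ := by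
      rw [yPoint, map_sum, Finset.sum_congr rfl (fun a _ => h1 a), Finset.sum_add_distrib, Finset.sum_const, hk,
        hz, add_zero]
    have hPτ : D.act D.tau P = P := by rw [hPdef, map_sub, hSτ, hyτ]
    rcases two_nsmul_eq_zero_or_ptOne_of_map_eq_self D.tau D.im D.im_sq htaui hτ2 P h4P hPτ with h0 | h1'
    · have : D.act (D.art t) P - P = 0 := map_sub_self_eq_zero_of_two_nsmul_eq_zero (D.art t) P h0
      rw [hσP] at this
      exact Point.some_ne_zero _ this
    · exact (map_sub_ne_zero_and_ne_ptOne_of_two_nsmul_eq_ptOne (D.art t) (hgen t ht) P h1').2 hσP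
  · -- `#ψ` odd: `σ_{1+ϖ}(P) − P = (0,0)`, impossible
    have hyτ : D.act D.tau (D.yPoint ψ) = D.yPoint ψ + ptZero := by
      rw [yPoint, map_sum, Finset.sum_congr rfl (fun a _ => h1 a), Finset.sum_add_distrib, Finset.sum_const,
        odd_nsmul_of_two_nsmul_eq_zero two_nsmul_ptZero hodd]
    have hPτ : D.act D.tau P - P = ptZero := by
      rw [hPdef, map_sub, hSτ, hyτ]; abel
    exact map_sub_ne_ptZero_of_two_nsmul_two_nsmul_eq_zero D.tau D.im D.im_sq htaui hτ2 P h4P hPτ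

end CMPointData

/-! ## §3 The prime case `n = p ≡ 7 (mod 8)`: `𝒜[2] = {1, [ϖ′]}` from Gauss -/

/-- **Gauss for `K = ℚ(√−2p)`, `p` an odd prime: `#Cl_K[2] = 2`** (`t = 2` ramified primes). [cite: Cox2013, Prop. 3.11]
[cite: LiMa2008, Thm. 0.4 (p. 280: "the 2-rank of Cl_K equals t − 1")] -/
theorem natCard_sq_eq_one_classGroup_genusField_two_mul_prime {p : ℕ} (hp : p.Prime) (hp2 : p ≠ 2) :
    Nat.card {c : ClassGroup (𝓞 (GenusField (2 * p))) // c ^ 2 = 1} = 2 := by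
  have hd1 : 1 ≤ 2 * p := by have := hp.two_le; omega
  obtain ⟨x, -, hx⟩ := exists_ringOfIntegers_sq_eq_neg (K := GenusField (2 * p)) (root_genusField_sq hd1)
  have hq : ∀ i, ((![2, p] : Fin 2 → ℕ) i).Prime := by
    intro i; fin_cases i
    · exact Nat.prime_two
    · exact hp
  have hinj : Function.Injective (![2, p] : Fin 2 → ℕ) := by
    intro i j hij
    fin_cases i <;> fin_cases j <;> simp_all
  have hodd : p % 2 = 1 := by
    rcases Nat.Prime.eq_two_or_odd hp with h | h
    · exact absurd h hp2
    · exact h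
  have hprod : ∏ i, (![2, p] : Fin 2 → ℕ) i = if (2 * p) % 4 = 1 then 2 * (2 * p) else 2 * p := by
    rw [if_neg (by omega), Fin.prod_univ_two]; rfl
  have := natCard_sq_eq_one_eq (finrank_genusField (2 * p)) hx hq hinj hprod
  simpa using this

namespace CMPointData

variable {n : ℕ}

/-- **Tian Prop. 4.6 for `m = 2p₀`, `p₀ ≡ 7 (mod 8)`, on the data — every transversal**: a transversal of `𝒜/[ϖ′]`
exists, and for every one the rational point `y″` with `transfer y″ = 2y_{2p₀,φ}` lies outside
`2E_{2p₀}(ℚ) + E_{2p₀}(ℚ)_tor` (Monsky Thm. 4.5 / Cor. 5.15 (1) «`2p₇`», for Tian's point). Inputs: `D.Printed`, the binder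
`hτ2` («`σ_{1+ϖ}` fixes `√2`», p0024 L1) and the binder `hgen` («`σ_t` moves `√2` for `[t] ∉ 2𝒜`», p0024 L26 — Tian's
Notations (ii) «`2𝒜 ≃ Gal(H/H₀)`» with `√2 ∈ H₀`); `𝒜[2] = {1, [ϖ′]}` is Gauss (a tree theorem).
[cite: Tian2014, Prop. 4.6 (p0023 L15–L22) and its proof (p0024 L6–L30)] [cite: Monsky1990MockHeegner, Thm. 4.5 (p. 57), Cor. 5.15 (1) (p. 66)] -/
theorem exists_transfer_eq_two_nsmul_yPoint_not_two_smul_add_torsion_prime_seven_mod_eight (D : CMPointData n)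
    (hn : n.Prime) (hn8 : n % 8 = 7) (hP : D.Printed) (hτ2 : ∀ s : D.H, s ^ 2 = 2 → D.tau s = s)
    (hgen : ∀ t : ClassGroup (𝓞 (GenusField (2 * n))), ¬ IsSquare t → ∀ s : D.H, s ^ 2 = 2 → D.art t s = -s) :
    (∃ φ, D.IsRepsModPiPrime φ) ∧
    ∀ φ : Finset (ClassGroup (𝓞 (GenusField (2 * n)))), D.IsRepsModPiPrime φ →
      ∃ y' : (congruentNumberCurve (2 * n)).toAffine.Point, D.transfer hn.ne_zero y' = (2 : ℕ) • D.yPoint φ ∧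
        ∀ z t : (congruentNumberCurve (2 * n)).toAffine.Point, IsOfFinAddOrder t → y' ≠ (2 : ℤ) • z + t := by
  have hπ : D.piPrime * D.piPrime = 1 ∧ D.piPrime ≠ 1 := hP.2.2.2.2.2.2.2.2.2
  have hn2 : n ≠ 2 := by rintro rfl; norm_num at hn8
  have hsq : Squarefree (2 * n) :=
    Nat.squarefree_mul_iff.mpr ⟨(Nat.coprime_primes Nat.prime_two hn).mpr (Ne.symm hn2),
      Nat.prime_two.prime.squarefree, hn.prime.squarefree⟩
  have h2 := eq_one_or_eq_of_mul_self_eq_one_of_natCard_eq_two D.piPrime hπ.1 hπ.2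
    (natCard_sq_eq_one_classGroup_genusField_two_mul_prime hn hn2)
  refine ⟨exists_isReps_of_mul_self_eq_one D.piPrime hπ.1 hπ.2, fun φ hφ => ?_⟩
  exact D.exists_transfer_eq_two_nsmul_yPoint_not_two_smul_add_torsion_seven hn.ne_zero hn8 hsq hP hτ2 hgen h2 hφ

end CMPointData

end Literature.NumberTheory.EllipticCurves.Tian2014

end
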